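import Mathlib.RingTheory.MvPowerSeries.Basic
import Mathlib.RingTheory.MvPowerSeries.Rename
import Mathlib.Data.Finsupp.Basic
import HarnessLib

/-!
# Power series in two groups of variables: `R⟦Xₛ, Y_t⟧ ≅ (R⟦Y_t⟧)⟦Xₛ⟧`

Topic: `Literature/AlgebraicGeometry/Resolution`. The power-series analogue of Mathlib's
`MvPolynomial.sumAlgEquiv` (`MvPolynomial (σ ⊕ τ) R ≃ MvPolynomial σ (MvPolynomial τ R)`), absent
from Mathlib: the ring isomorphism

  `nestedEquiv σ τ R : MvPowerSeries (σ ⊕ τ) R ≃+* MvPowerSeries σ (MvPowerSeries τ R)`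

sending `X (inl s) ↦ X s`, `X (inr t) ↦ C (X t)`, `C r ↦ C (C r)`; on coefficients,
`coeff e (coeff d (nestedEquiv f)) = coeff (d ⊔ e) f` for the exponent `d ⊔ e` on `σ ⊕ τ` with
components `d`, `e` (Mathlib's `Finsupp.sumFinsuppAddEquivProdFinsupp`). Its inverse restricted
to constants is the inclusion `inrHom : R⟦Y_t⟧ → R⟦Xₛ, Y_t⟧` of the series in the second group
of variables (`= MvPowerSeries.rename Sum.inr`).

It is used to pass from Liu's form `Â⟦u, v⟧/(uv - h)`, `Â ≅ k⟦t₁, …, t_m⟧` (Cohen), of the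
complete local ring of a semi-stable curve at a split node (de Jong 1996, 2.23;
`NodalDeformation.lean`) to de Jong's `k⟦u, v, t₁, …, t_m⟧/(uv - h(t))`
(`DeJong1996.NodalPowRing`, `AlterationsCodimThreeNodalFormParts.lean`). Everything is [folklore].
-/

noncomputable section

namespace Literature.AlgebraicGeometry.Resolution

namespace MvPowerSeriesNested

open MvPowerSeries Finsupp

variable {σ τ : Type*} {R : Type*} [CommRing R]

/-- The splitting of an exponent on `σ ⊕ τ` into its two components. [folklore] -/
abbrev split : (σ ⊕ τ →₀ ℕ) ≃+ (σ →₀ ℕ) × (τ →₀ ℕ) :=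
  Finsupp.sumFinsuppAddEquivProdFinsupp

/-- The forward map `R⟦Xₛ, Y_t⟧ → (R⟦Y_t⟧)⟦Xₛ⟧` on coefficients. [folklore] -/
def toNested (f : MvPowerSeries (σ ⊕ τ) R) : MvPowerSeries σ (MvPowerSeries τ R) :=
  show MvPowerSeries σ (MvPowerSeries τ R) from fun d =>
    show MvPowerSeries τ R from fun e => coeff (split.symm (d, e)) f

/-- The backward map `(R⟦Y_t⟧)⟦Xₛ⟧ → R⟦Xₛ, Y_t⟧` on coefficients. [folklore] -/
def ofNested (F : MvPowerSeries σ (MvPowerSeries τ R)) : MvPowerSeries (σ ⊕ τ) R :=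
  show MvPowerSeries (σ ⊕ τ) R from fun n => coeff (split n).2 (coeff (split n).1 F)

/-- Coefficients of `toNested`. [folklore] -/
@[simp]
theorem coeff_coeff_toNested (f : MvPowerSeries (σ ⊕ τ) R) (d : σ →₀ ℕ) (e : τ →₀ ℕ) :
    coeff e (coeff d (toNested f)) = coeff (split.symm (d, e)) f :=
  rfl

/-- Coefficients of `ofNested`. [folklore] -/
@[simp]
theorem coeff_ofNested (F : MvPowerSeries σ (MvPowerSeries τ R)) (n : σ ⊕ τ →₀ ℕ) :
    coeff n (ofNested F) = coeff (split n).2 (coeff (split n).1 F) :=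
  rfl

/-- `toNested` is multiplicative: the antidiagonal of `d ⊔ e` is the product of the
antidiagonals of `d` and `e`. [folklore] -/
theorem toNested_mul (f g : MvPowerSeries (σ ⊕ τ) R) :
    toNested (f * g) = toNested f * toNested g := by
  classical
  ext d e
  rw [coeff_coeff_toNested, coeff_mul, coeff_mul, map_sum]
  simp_rw [coeff_mul, coeff_coeff_toNested]
  rw [← Finset.sum_product']
  -- reindex along `antidiagonal (d ⊔ e) ≃ antidiagonal d × antidiagonal e`
  refine Finset.sum_nbij'
    (fun x => (((split x.1).1, (split x.2).1), ((split x.1).2, (split x.2).2)))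
    (fun y => (split.symm (y.1.1, y.2.1), split.symm (y.1.2, y.2.2))) ?_ ?_ ?_ ?_ ?_
  · rintro ⟨p, q⟩ hpq
    rw [Finset.HasAntidiagonal.mem_antidiagonal] at hpq
    simp only [Finset.mem_product, Finset.HasAntidiagonal.mem_antidiagonal]
    have h := congrArg split hpq
    rw [map_add, AddEquiv.apply_symm_apply, Prod.ext_iff] at h
    exact ⟨h.1, h.2⟩
  · rintro ⟨⟨p₁, q₁⟩, ⟨p₂, q₂⟩⟩ h
    simp only [Finset.mem_product, Finset.HasAntidiagonal.mem_antidiagonal] at h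
    rw [Finset.HasAntidiagonal.mem_antidiagonal, ← map_add, Prod.mk_add_mk, h.1, h.2]
  · rintro ⟨p, q⟩ -
    simp only [Prod.mk.eta, AddEquiv.symm_apply_apply]
  · rintro ⟨⟨p₁, q₁⟩, ⟨p₂, q₂⟩⟩ -
    simp only [AddEquiv.apply_symm_apply]
  · rintro ⟨p, q⟩ -
    simp only [Prod.mk.eta, AddEquiv.symm_apply_apply]

/-- **`R⟦Xₛ, Y_t⟧ ≅ (R⟦Y_t⟧)⟦Xₛ⟧`** (the power-series analogue of `MvPolynomial.sumAlgEquiv`).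
[folklore] -/
def nestedEquiv (σ τ R : Type*) [CommRing R] :
    MvPowerSeries (σ ⊕ τ) R ≃+* MvPowerSeries σ (MvPowerSeries τ R) where
  toFun := toNested
  invFun := ofNested
  left_inv f := by
    ext n
    rw [coeff_ofNested, coeff_coeff_toNested, Prod.mk.eta, AddEquiv.symm_apply_apply]
  right_inv F := by
    ext d e
    rw [coeff_coeff_toNested, coeff_ofNested, AddEquiv.apply_symm_apply]
  map_mul' := toNested_mul
  map_add' f g := by
    ext d e
    simp only [coeff_coeff_toNested, map_add]

/-- Coefficients of `nestedEquiv`. [folklore] -/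
@[simp]
theorem coeff_coeff_nestedEquiv (f : MvPowerSeries (σ ⊕ τ) R) (d : σ →₀ ℕ) (e : τ →₀ ℕ) :
    coeff e (coeff d (nestedEquiv σ τ R f)) = coeff (split.symm (d, e)) f :=
  rfl

/-- Coefficients of `nestedEquiv.symm`. [folklore] -/
@[simp]
theorem coeff_nestedEquiv_symm (F : MvPowerSeries σ (MvPowerSeries τ R)) (n : σ ⊕ τ →₀ ℕ) :
    coeff n ((nestedEquiv σ τ R).symm F) = coeff (split n).2 (coeff (split n).1 F) :=
  rfl

/-- The exponent of `X (inl s)` splits as `(single s 1, 0)`. [folklore] -/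
theorem split_single_inl (s : σ) :
    split (Finsupp.single (Sum.inl s) 1 : σ ⊕ τ →₀ ℕ) = (Finsupp.single s 1, 0) := by
  classical
  refine Prod.ext ?_ ?_
  · ext x
    rw [fst_sumFinsuppAddEquivProdFinsupp, Finsupp.single_apply, Finsupp.single_apply]
    simp [Sum.inl_injective.eq_iff]
  · ext y
    rw [snd_sumFinsuppAddEquivProdFinsupp, Finsupp.single_apply]
    simp

/-- The exponent of `X (inr t)` splits as `(0, single t 1)`. [folklore] -/
theorem split_single_inr (t : τ) :
    split (Finsupp.single (Sum.inr t) 1 : σ ⊕ τ →₀ ℕ) = (0, Finsupp.single t 1) := by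
  classical
  refine Prod.ext ?_ ?_
  · ext x
    rw [fst_sumFinsuppAddEquivProdFinsupp, Finsupp.single_apply]
    simp
  · ext y
    rw [snd_sumFinsuppAddEquivProdFinsupp, Finsupp.single_apply, Finsupp.single_apply]
    simp [Sum.inr_injective.eq_iff]

/-- `nestedEquiv (X (inl s)) = X s`. [folklore] -/
@[simp]
theorem nestedEquiv_X_inl (s : σ) :
    nestedEquiv σ τ R (X (Sum.inl s)) = X s := by
  classical
  ext d e
  rw [coeff_coeff_nestedEquiv, coeff_X, coeff_X]
  have key : split.symm (d, e) = Finsupp.single (Sum.inl s) 1 ↔ d = Finsupp.single s 1 ∧ e = 0 := by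
    rw [AddEquiv.symm_apply_eq, split_single_inl, Prod.ext_iff]
  by_cases hd : d = Finsupp.single s 1
  · by_cases he : e = 0
    · rw [if_pos (key.mpr ⟨hd, he⟩), if_pos hd, he, coeff_zero_eq_constantCoeff_apply, map_one]
    · rw [if_neg (fun h => he (key.mp h).2), if_pos hd, coeff_one, if_neg he]
  · rw [if_neg (fun h => hd (key.mp h).1), if_neg hd, map_zero]

/-- `nestedEquiv (X (inr t)) = C (X t)`. [folklore] -/
@[simp]
theorem nestedEquiv_X_inr (t : τ) :
    nestedEquiv σ τ R (X (Sum.inr t)) = C (X t) := by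
  classical
  ext d e
  rw [coeff_coeff_nestedEquiv, coeff_X, coeff_C]
  have key : split.symm (d, e) = Finsupp.single (Sum.inr t) 1 ↔ d = 0 ∧ e = Finsupp.single t 1 := by
    rw [AddEquiv.symm_apply_eq, split_single_inr, Prod.ext_iff]
  by_cases hd : d = 0
  · subst hd
    rw [if_pos rfl, coeff_X]
    by_cases he : e = Finsupp.single t 1
    · rw [if_pos (key.mpr ⟨rfl, he⟩), if_pos he]
    · rw [if_neg (fun h => he (key.mp h).2), if_neg he]
  · rw [if_neg (fun h => hd (key.mp h).1), if_neg hd, map_zero]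

/-- `nestedEquiv (C r) = C (C r)`. [folklore] -/
@[simp]
theorem nestedEquiv_C (r : R) :
    nestedEquiv σ τ R (C r) = C (C r) := by
  classical
  ext d e
  rw [coeff_coeff_nestedEquiv, coeff_C, coeff_C]
  have key : split.symm (d, e) = 0 ↔ d = 0 ∧ e = 0 := by
    rw [AddEquiv.symm_apply_eq, map_zero, Prod.ext_iff]
    rfl
  by_cases hd : d = 0
  · subst hd
    rw [if_pos rfl, coeff_C]
    by_cases he : e = 0
    · rw [if_pos (key.mpr ⟨rfl, he⟩), if_pos he]
    · rw [if_neg (fun h => he (key.mp h).2), if_neg he]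
  · rw [if_neg (fun h => hd (key.mp h).1), if_neg hd, map_zero]

/-! ## The series in the second group of variables -/

/-- The inclusion `R⟦Y_t⟧ → R⟦Xₛ, Y_t⟧` of the series in the second group of variables, as the
constants of `(R⟦Y_t⟧)⟦Xₛ⟧`. [folklore] -/
def inrHom (σ τ R : Type*) [CommRing R] : MvPowerSeries τ R →+* MvPowerSeries (σ ⊕ τ) R :=
  (nestedEquiv σ τ R).symm.toRingHom.comp C

/-- `nestedEquiv` inverts `inrHom` to the constants. [folklore] -/
@[simp]
theorem nestedEquiv_inrHom (p : MvPowerSeries τ R) : nestedEquiv σ τ R (inrHom σ τ R p) = C p :=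
  (nestedEquiv σ τ R).apply_symm_apply _

/-- Coefficients of `inrHom p`: those of `p` at exponents not involving the first group of
variables, zero elsewhere. [folklore] -/
theorem coeff_inrHom [DecidableEq σ] (p : MvPowerSeries τ R) (n : σ ⊕ τ →₀ ℕ) :
    coeff n (inrHom σ τ R p) = if (split n).1 = 0 then coeff (split n).2 p else 0 := by
  change coeff n ((nestedEquiv σ τ R).symm (C p)) = _
  rw [coeff_nestedEquiv_symm, coeff_C]
  split_ifs <;> rfl

/-- `inrHom (X t) = X (inr t)`. [folklore] -/
@[simp]
theorem inrHom_X (t : τ) : inrHom σ τ R (X t) = X (Sum.inr t) := by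
  apply (nestedEquiv σ τ R).injective
  rw [nestedEquiv_inrHom, nestedEquiv_X_inr]

/-- `inrHom (C r) = C r`. [folklore] -/
@[simp]
theorem inrHom_C (r : R) : inrHom σ τ R (C r) = C r := by
  apply (nestedEquiv σ τ R).injective
  rw [nestedEquiv_inrHom, nestedEquiv_C]

/-- `inrHom` is injective. [folklore] -/
theorem inrHom_injective : Function.Injective (inrHom σ τ R) :=
  (nestedEquiv σ τ R).symm.injective.comp (fun _ _ h => MvPowerSeries.C_injective h)

/-- `inrHom` is Mathlib's renaming along `Sum.inr` (whenever Mathlib's `rename` is available,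
e.g. for finite `τ`). [folklore] -/
theorem inrHom_eq_rename [Filter.TendstoCofinite (Sum.inr : τ → σ ⊕ τ)] (p : MvPowerSeries τ R) :
    inrHom σ τ R p = MvPowerSeries.rename (Sum.inr : τ → σ ⊕ τ) p := by
  classical
  ext n
  rw [coeff_inrHom]
  split_ifs with h
  · -- `n = embDomain inr (split n).2`
    have hn : n = Finsupp.mapDomain (Sum.inr : τ → σ ⊕ τ) (split n).2 := by
      ext i
      rcases i with s | t
      · rw [Finsupp.mapDomain_notin_range _ _ (by simp)]
        have := congrArg (fun q : σ →₀ ℕ => q s) h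
        simpa [fst_sumFinsuppAddEquivProdFinsupp] using this
      · rw [Finsupp.mapDomain_apply Sum.inr_injective, snd_sumFinsuppAddEquivProdFinsupp]
    have key := MvPowerSeries.coeff_embDomain_rename (Function.Embedding.inr : τ ↪ σ ⊕ τ) p
      (split n).2
    rw [Finsupp.embDomain_eq_mapDomain] at key
    conv_rhs => rw [hn]
    exact key.symm
  · symm
    refine MvPowerSeries.coeff_rename_eq_zero _ p fun ⟨q, hq⟩ => h ?_
    ext s
    rw [fst_sumFinsuppAddEquivProdFinsupp, ← hq, Finsupp.mapDomain_notin_range _ _ (by simp)]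
    rfl

/-- The constant coefficient of `inrHom p` is that of `p`. [folklore] -/
theorem constantCoeff_inrHom (p : MvPowerSeries τ R) :
    constantCoeff (inrHom σ τ R p) = constantCoeff p := by
  classical
  rw [← coeff_zero_eq_constantCoeff_apply, coeff_inrHom, map_zero, Prod.fst_zero, Prod.snd_zero,
    if_pos rfl, coeff_zero_eq_constantCoeff_apply]

end MvPowerSeriesNested

end Literature.AlgebraicGeometry.Resolution

end
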